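import Summits.QuantumFields.BalabanUV.Gaps.D1CoDressedLongitudinalForm
import Summits.QuantumFields.BalabanUV.Gaps.D1ReynoldsMeanPairs

/-!
# `BalabanUV.Gaps.D1WardTraceForm` — cell pub-balaban-gaps, row (D1), seat g1-p1: UNDER THE WARD BINDER ALONE THE CHANNEL SUM OF THE (1.22) COEFFICIENTS — HENCE THE S₄-REYNOLDS MEAN's
# COEFFICIENT, AND UNDER (1.21) EVERY CHANNEL's — IS −½ × THE ISOTROPIC SECOND MOMENT `Σ_z tr T_j(z)·|z|²` OF THE TRACE KERNEL: an axis-order-blind scalar reading of the drift coefficient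

HONEST FRAMING (cell rule, page 1 of everything): [folklore] composition BY NAME — rows 86∕87 of this seat (`D1WardLongitudinalForm.secondMoment_eq_neg_half_of_ward_indexSymmetric`: under (5.9) +
(5.8) + summable third moments `β(μ,ν) = −½ Σ_z P_{νν}(z) z_μ²`; `D1CoDressedLongitudinalForm` for an2's chart-(II) literal), leaf-01's `D1BFx.WardDiagonalSecondMoment.sqMoment_self_eq_zero_of_ward`
(`Σ_z P_{νν}(z) z_ν² = 0`) and `D1BFx.PermCovariantReynolds` (`reynoldsMean`, `card_pairs_mul_secondMoment_reynoldsMean`), GEN 14's `D1ReynoldsMeanPairs` (`twelve_mul_secondMoment_reynoldsMean_JsBalAn1 ∕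
_JsB12CombShSym`, `summable_secondMoment_of_momentSummable`, `sum_pairs_indicator_four`) and `D1IndexSymmetryDictionary.momentSummable_flipK_TbalOf`, GEN 14's (5.8) theorems, the β sub-cell's
`B12Beta.secondMoment_pair_indep` ((1.21) ⟹ pair independence) and `RowD1SymmetriesDischarged.symmetries_JsRowD1Pin`.  The Ward binder `hW` (5.9) at the pinned ∕ (III′) literals and the
permutation covariance `PermCovariant` (1.21) wherever it appears REMAIN HYPOTHESES ((1.21) FAILS by value for the record's level-0 kernel, census row 85h — it is used here only as a displayed
hypothesis); NOTHING of Bałaban's asserted beyond print ((1.21), (1.22) p. 264, (5.8)–(5.9) p. 293 of [Balaban1987RG1] are PRINTED for Bałaban's `Π`, predicates here); NO coefficient computed or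
signed; (D1) NOT discharged; 0∕4 row-D1 binders at the pinned ∕ (III′) literals; NOT `BetaPertH`, NOT continuum, NOT Clay.
HONEST DEPENDENCY (b2b cell, verbatim): «continuum YM on T⁴ ⇐ BetaPertH ∧ nine spine estimates (0/9 proved); BetaPertH ⇐ (D1) ∧ (D4) ∧ CAP+tail; G-an2-4 gates asym, D1 and NE2/3/4.»

WHY (census row 88 of `HOME/g1/RESIDUE.md`).  Row 86 reads each off-diagonal (1.22) coefficient on ONE diagonal channel.  Summing over channels, the diagonal channel `ν` contributes
`Σ_{μ ≠ ν} Σ_z P_{νν}(z) z_μ² = Σ_z P_{νν}(z) (|z|² − z_ν²) = Σ_z P_{νν}(z) |z|²` (the one-axis square drops by Ward), so UNDER (5.9) + (5.8) + SUMMABLE THIRD MOMENTS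
**`Σ_{μ ≠ ν} β(μ,ν) = −½ Σ_ν Σ_z P_{νν}(z) |z|²`** — the ISOTROPIC second moment of the TRACE kernel `z ↦ Σ_ν P_{νν}(z)`, a scalar that does not see the ORDER of the axes (the axial
gauge's known defect, row 85h: the record's level-0 kernel breaks (1.21) at 31 % while its second moments are isotropic to 0.12 %).  Consequences: (i) the S₄-REYNOLDS MEAN's coefficient (GEN 14,
rows 83c–83e: «(D1) at six channels ⟹ the drift law for the mean») is `−(1∕24) Σ_ν Σ_z T_j(ν,ν,z) |z|²` under `hW_j` alone at the pinned and (III′) literals, and HYPOTHESIS-FREE at an2's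
chart-(II) literal `JsRowD1Pin`; (ii) under (1.21) at level `j` EVERY channel's coefficient is that scalar (`secondMoment_pair_indep`); (iii) for Engine C: a FOURTH kernel-exact estimator of the
drift coefficient, `β̄_j = −(1∕24) Σ_z tr K_j(z) |z|²`, insensitive to axis labelling.
WHAT IT IS NOT: `hW`, `PermCovariant`, `ConvPSD`, `D1Tel`, `D1Rep` remain HYPOTHESES where displayed; nothing is discharged; the words of the row do not move.

CONTENT (all [folklore]; no `def`, 0 sorry): §1 generic `P : B12Beta.Kernel d` under {`MomentSummable P 3`, `WardTransversal P`, `IndexSymmetric P`}: `sum_offDiag_secondMoment_col` (one column),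
**`sum_offDiag_secondMoment_eq_trace`** (`Σ_a Σ_b [a ≠ b] β(a,b) = −½ Σ_ν Σ_z P_{νν}(z) Σ_μ z_μ²`), `tsum_diag_normSq_flipK` (the trace moment is flip-blind); `d = 4`:
**`twelve_mul_secondMoment_eq_trace_of_permCovariant`** (+ (1.21): `12·β(μ,ν) = −½ Σ_ν Σ_z P_{νν}(z)|z|²`, `μ ≠ ν`), **`twelve_mul_secondMoment_reynoldsMean_eq_trace`** (no (1.21): the Reynolds
mean's coefficient); §2 the pinned family under `hW_j`: **`twelve_mul_secondMoment_reynoldsMean_JsBalAn1_eq_trace_of_hW`**, `secondMoment_TbalOf_JsBalAn1_eq_trace_of_hW_permCovariant`; §3 an2's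
chart-(II) literal `JsRowD1Pin hLc N` (`Odd Lc`, `2 ≤ N`), HYPOTHESIS-FREE: **`twelve_mul_secondMoment_reynoldsMean_JsRowD1Pin_eq_trace`**, `secondMoment_TbalOf_JsRowD1Pin_eq_trace_of_permCovariant`;
§4 the (III′) literal under `hW_j`: `twelve_mul_secondMoment_reynoldsMean_JsB12CombShSym_eq_trace_of_hW`.

Provenance: cell pub-balaban-gaps, seat g1-p1 GEN 17 (prover-pub-balaban-gaps-g1-p1-g17-0), 2026-08-25; imports this seat's `Gaps/D1CoDressedLongitudinalForm` (p402229 ✓; through it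
`D1WardLongitudinalForm` p401914 ✓) + GEN 14's `Gaps/D1ReynoldsMeanPairs`; no existing file touched.
-/

noncomputable section

open Literature.MathematicalPhysics.QuantumFieldTheory Balaban1983to89 Balaban1983to89.Beta
open OneStepResolventKernel (JetData)
open OneStepKernelFamily (TbalOf flipK secondMoment_flipK)
open PolarizationSign (IndexSymmetric WardTransversal MomentSummable)
open AffineAveraging (box)
open Summit.QuantumFields.BalabanUV.Beta.MixedJetTablesPlug (JsBalAn1)
open Summit.QuantumFields.BalabanUV.Beta.CombChartJointEnd (JsB12CombShSym)
open Summit.QuantumFields.BalabanUV.Beta.SymmetrisedStepJets (SymTables)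
open Summit.QuantumFields.BalabanUV.Beta.RowD1JointEnd (JsRowD1Pin)
open Summit.QuantumFields.BalabanUV.Beta.RowD1SymmetriesDischarged (symmetries_JsRowD1Pin)
open Summit.QuantumFields.BalabanUV.Beta.D1BFx.WardDiagonalSecondMoment (sqMoment_self_eq_zero_of_ward momentSummable_mul_pow)
open Summit.QuantumFields.BalabanUV.Beta.D1BFx.PermCovariantReynolds (reynoldsMean card_pairs_mul_secondMoment_reynoldsMean)
open Summit.QuantumFields.BalabanUV.Gaps.D1IndexSymmetryDictionary (momentSummable_flipK_TbalOf)
open Summit.QuantumFields.BalabanUV.Gaps.D1PinnedIndexSymmetry (indexSymmetric_flipK_TbalOf_JsBalAn1)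
open Summit.QuantumFields.BalabanUV.Gaps.D1RecordIndexSymmetry (indexSymmetric_flipK_TbalOf_JsB12CombShSym)
open Summit.QuantumFields.BalabanUV.Gaps.D1ReynoldsMeanPairs (summable_secondMoment_of_momentSummable sum_pairs_indicator_four twelve_mul_secondMoment_reynoldsMean_JsBalAn1
  twelve_mul_secondMoment_reynoldsMean_JsB12CombShSym)
open Summit.QuantumFields.BalabanUV.Gaps.D1WardLongitudinalForm (secondMoment_eq_neg_half_of_ward_indexSymmetric)
open Summit.QuantumFields.BalabanUV.Gaps.D1CoDressedLongitudinalForm (indexSymmetric_flipK_TbalOf_JsRowD1Pin)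

namespace Summit.QuantumFields.BalabanUV.Gaps.D1WardTraceForm

/-! ## §1 Generic kernels: the channel sum of (1.22) is the trace kernel's isotropic second moment -/

section Generic

variable {d : ℕ}

/-- [folklore] ONE COLUMN: under (5.9) + (5.8) + summable third moments, for every second index `ν`,
`Σ_μ [μ ≠ ν] secondMoment P μ ν = −½ Σ_z P_{νν}(z) · Σ_μ z_μ²` — row 86's `β(μ,ν) = −½ Σ_z P_{νν}(z) z_μ²` for `μ ≠ ν`, the missing term `μ = ν` being `Σ_z P_{νν}(z) z_ν² = 0`
(leaf-01's `sqMoment_self_eq_zero_of_ward`), and the finite sum taken inside the lattice sum. -/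
theorem sum_offDiag_secondMoment_col {P : B12Beta.Kernel d} (hP : MomentSummable P 3) (hT : WardTransversal P) (hS : IndexSymmetric P) (ν : Fin d) :
    (∑ μ, if μ = ν then (0 : ℝ) else B12Beta.secondMoment P μ ν) = -(1 / 2) * ∑' z, P ν ν z * ∑ μ, (z μ : ℝ) ^ 2 := by
  have hterm : ∀ μ, (if μ = ν then (0 : ℝ) else B12Beta.secondMoment P μ ν) = -(1 / 2) * ∑' z, P ν ν z * (z μ : ℝ) ^ 2 := by
    intro μ
    by_cases h : μ = ν
    · subst h
      rw [if_pos rfl, sqMoment_self_eq_zero_of_ward hP hT μ μ, mul_zero]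
    · rw [if_neg h]
      exact secondMoment_eq_neg_half_of_ward_indexSymmetric hP hT hS h
  simp_rw [hterm]
  rw [← Finset.mul_sum, ← Summable.tsum_finsetSum (fun μ _ => momentSummable_mul_pow hP ν ν μ (by norm_num))]
  congr 1
  exact tsum_congr fun z => (Finset.mul_sum _ _ _).symm

/-- [folklore] **THE CHANNEL SUM OF THE (1.22) COEFFICIENTS IS −½ THE ISOTROPIC SECOND MOMENT OF THE TRACE KERNEL**: under (5.9) + (5.8) + summable third moments,
`Σ_a Σ_b [a ≠ b] secondMoment P a b = −½ Σ_ν Σ_z P_{νν}(z) · Σ_μ z_μ²` — a scalar blind to the ORDER of the axes. -/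
theorem sum_offDiag_secondMoment_eq_trace {P : B12Beta.Kernel d} (hP : MomentSummable P 3) (hT : WardTransversal P) (hS : IndexSymmetric P) :
    (∑ a, ∑ b, if a = b then (0 : ℝ) else B12Beta.secondMoment P a b) = -(1 / 2) * ∑ ν, ∑' z, P ν ν z * ∑ μ, (z μ : ℝ) ^ 2 := by
  rw [Finset.sum_comm]
  simp_rw [sum_offDiag_secondMoment_col hP hT hS]
  rw [Finset.mul_sum]

/-- [folklore] The trace kernel's isotropic moment is blind to the flip `z ↦ −z` (re-indexing by `Equiv.neg`; no summability). -/
theorem tsum_diag_normSq_flipK (T : B12Beta.Kernel d) (ν : Fin d) :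
    ∑' z, flipK T ν ν z * ∑ μ, (z μ : ℝ) ^ 2 = ∑' z, T ν ν z * ∑ μ, (z μ : ℝ) ^ 2 := by
  rw [← (Equiv.neg (Fin d → ℤ)).tsum_eq (fun x => T ν ν x * ∑ μ, (x μ : ℝ) ^ 2)]
  refine tsum_congr fun x => ?_
  simp only [OneStepKernelFamily.flipK_apply, Equiv.neg_apply, Pi.neg_apply, Int.cast_neg, neg_sq]

/-- [folklore] **THE S₄-REYNOLDS MEAN's (1.22) COEFFICIENT IS THE TRACE SCALAR** (`d = 4`, no (1.21) assumed): under (5.9) + (5.8) + summable third moments, for `μ ≠ ν`,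
`12 · secondMoment (reynoldsMean P) μ ν = −½ Σ_ν Σ_z P_{νν}(z) |z|²` — leaf-01's `card_pairs_mul_secondMoment_reynoldsMean` + `sum_offDiag_secondMoment_eq_trace`. -/
theorem twelve_mul_secondMoment_reynoldsMean_eq_trace {P : B12Beta.Kernel 4} (hP : MomentSummable P 3) (hT : WardTransversal P) (hS : IndexSymmetric P) {μ ν : Fin 4} (hμν : μ ≠ ν) :
    12 * B12Beta.secondMoment (reynoldsMean P) μ ν = -(1 / 2) * ∑ ν, ∑' z, P ν ν z * ∑ μ, (z μ : ℝ) ^ 2 := by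
  have h := card_pairs_mul_secondMoment_reynoldsMean (summable_secondMoment_of_momentSummable hP) hμν
  rw [sum_pairs_indicator_four, sum_offDiag_secondMoment_eq_trace hP hT hS] at h
  exact h

/-- [folklore] **UNDER (1.21) EVERY CHANNEL's COEFFICIENT IS THE TRACE SCALAR** (`d = 4`): (5.9) + (5.8) + summable third moments + `PermCovariant P` ⟹ for `μ ≠ ν`
`12 · secondMoment P μ ν = −½ Σ_ν Σ_z P_{νν}(z) |z|²` — the twelve ordered off-diagonal values coincide (`B12Beta.secondMoment_pair_indep`) and sum to the trace scalar. -/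
theorem twelve_mul_secondMoment_eq_trace_of_permCovariant {P : B12Beta.Kernel 4} (hP : MomentSummable P 3) (hT : WardTransversal P) (hS : IndexSymmetric P)
    (hC : B12Beta.PermCovariant P) {μ ν : Fin 4} (hμν : μ ≠ ν) :
    12 * B12Beta.secondMoment P μ ν = -(1 / 2) * ∑ ν, ∑' z, P ν ν z * ∑ μ, (z μ : ℝ) ^ 2 := by
  rw [← sum_offDiag_secondMoment_eq_trace hP hT hS]
  have h : ∀ a b : Fin 4, (if a = b then (0 : ℝ) else B12Beta.secondMoment P a b) = (if a = b then (0 : ℝ) else 1) * B12Beta.secondMoment P μ ν := by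
    intro a b
    by_cases hab : a = b
    · rw [if_pos hab, if_pos hab, zero_mul]
    · rw [if_neg hab, if_neg hab, one_mul, B12Beta.secondMoment_pair_indep hC hμν hab]
  simp_rw [h, ← Finset.sum_mul]
  rw [sum_pairs_indicator_four]

end Generic

/-! ## §2 The β-lead's pinned family under `hW_j` -/

section Pinned

variable {Lc : ℕ} [NeZero Lc] {r : Fin (3 + 1) → ℕ}

/-- [folklore] **THE REYNOLDS MEAN's COEFFICIENT OF THE PINNED FAMILY UNDER `hW_j` IS THE TRACE SCALAR**: for `P := flipK (TbalOf Lc (JsBalAn1 …) j)` Ward-transversal and `μ ≠ ν`,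
`12 · secondMoment (reynoldsMean P) μ ν = −½ Σ_ν Σ_z T_j(ν,ν,z) |z|²` ((5.8) GEN 14; summability GEN 14; the flip removed by `tsum_diag_normSq_flipK`).  GEN 14's rows 83c–83e turn (D1) at six
channels into the drift law for this mean; here is what that mean's level coefficient IS. -/
theorem twelve_mul_secondMoment_reynoldsMean_JsBalAn1_eq_trace_of_hW (hLc : 1 ≤ Lc) (hr : r ∈ box (3 + 1) Lc) (cE cVH cΛ cE₂ cB : ℝ) (T : Fin 4 → Fin 4 → Fin 4 → Fin 4 → ℝ) (j : ℕ)
    (hW : WardTransversal (flipK (TbalOf Lc (JsBalAn1 hLc hr cE cVH cΛ cE₂ cB T) j))) {μ ν : Fin 4} (hμν : μ ≠ ν) :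
    12 * B12Beta.secondMoment (reynoldsMean (flipK (TbalOf Lc (JsBalAn1 hLc hr cE cVH cΛ cE₂ cB T) j))) μ ν =
      -(1 / 2) * ∑ ν, ∑' z, TbalOf Lc (JsBalAn1 hLc hr cE cVH cΛ cE₂ cB T) j ν ν z * ∑ μ, (z μ : ℝ) ^ 2 := by
  rw [twelve_mul_secondMoment_reynoldsMean_eq_trace (momentSummable_flipK_TbalOf _ j 3) hW (indexSymmetric_flipK_TbalOf_JsBalAn1 hLc hr cE cVH cΛ cE₂ cB T j) hμν]
  simp_rw [tsum_diag_normSq_flipK]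

/-- [folklore] … and under `hW_j` + the printed (1.21) for the flipped level-`j` kernel (a HYPOTHESIS; by value it fails for the record, row 85h): EVERY channel's coefficient is that scalar,
`12 · β⁰_j(μ,ν) = −½ Σ_ν Σ_z T_j(ν,ν,z) |z|²` (`μ ≠ ν`). -/
theorem secondMoment_TbalOf_JsBalAn1_eq_trace_of_hW_permCovariant (hLc : 1 ≤ Lc) (hr : r ∈ box (3 + 1) Lc) (cE cVH cΛ cE₂ cB : ℝ) (T : Fin 4 → Fin 4 → Fin 4 → Fin 4 → ℝ) (j : ℕ)
    (hW : WardTransversal (flipK (TbalOf Lc (JsBalAn1 hLc hr cE cVH cΛ cE₂ cB T) j))) (hC : B12Beta.PermCovariant (flipK (TbalOf Lc (JsBalAn1 hLc hr cE cVH cΛ cE₂ cB T) j)))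
    {μ ν : Fin 4} (hμν : μ ≠ ν) :
    12 * B12Beta.secondMoment (TbalOf Lc (JsBalAn1 hLc hr cE cVH cΛ cE₂ cB T) j) μ ν =
      -(1 / 2) * ∑ ν, ∑' z, TbalOf Lc (JsBalAn1 hLc hr cE cVH cΛ cE₂ cB T) j ν ν z * ∑ μ, (z μ : ℝ) ^ 2 := by
  rw [← secondMoment_flipK, twelve_mul_secondMoment_eq_trace_of_permCovariant (momentSummable_flipK_TbalOf _ j 3) hW (indexSymmetric_flipK_TbalOf_JsBalAn1 hLc hr cE cVH cΛ cE₂ cB T j) hC hμν]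
  simp_rw [tsum_diag_normSq_flipK]

end Pinned

/-! ## §3 an2's chart-(II) literal `JsRowD1Pin hLc N`: hypothesis-free -/

section CoDressed

variable {Lc : ℕ} [NeZero Lc]

/-- [folklore] **THE REYNOLDS MEAN's COEFFICIENT OF an2's CHART-(II) LITERAL IS THE TRACE SCALAR, HYPOTHESIS-FREE** (`Odd Lc`, `2 ≤ N`, every level, `μ ≠ ν`):
`12 · secondMoment (reynoldsMean (flipK T_j)) μ ν = −½ Σ_ν Σ_z T_j(ν,ν,z) |z|²`, `T_j := TbalOf Lc (JsRowD1Pin hLc N) j` — `hW` the owner's theorem, (5.8) road FP's. -/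
theorem twelve_mul_secondMoment_reynoldsMean_JsRowD1Pin_eq_trace (hLc : Odd Lc) {N : ℕ} (hN : 2 ≤ N) (j : ℕ) {μ ν : Fin 4} (hμν : μ ≠ ν) :
    12 * B12Beta.secondMoment (reynoldsMean (flipK (TbalOf Lc (JsRowD1Pin hLc N) j))) μ ν =
      -(1 / 2) * ∑ ν, ∑' z, TbalOf Lc (JsRowD1Pin hLc N) j ν ν z * ∑ μ, (z μ : ℝ) ^ 2 := by
  rw [twelve_mul_secondMoment_reynoldsMean_eq_trace (momentSummable_flipK_TbalOf _ j 3) ((symmetries_JsRowD1Pin hLc hN).1 j) (indexSymmetric_flipK_TbalOf_JsRowD1Pin hLc N j) hμν]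
  simp_rw [tsum_diag_normSq_flipK]

/-- [folklore] … and under the printed (1.21) for that literal's flipped level-`j` kernel (a HYPOTHESIS, neither proved nor refuted in the tree): `12 · β⁰_j(μ,ν) = −½ Σ_ν Σ_z T_j(ν,ν,z) |z|²`
(`μ ≠ ν`). -/
theorem secondMoment_TbalOf_JsRowD1Pin_eq_trace_of_permCovariant (hLc : Odd Lc) {N : ℕ} (hN : 2 ≤ N) (j : ℕ) (hC : B12Beta.PermCovariant (flipK (TbalOf Lc (JsRowD1Pin hLc N) j)))
    {μ ν : Fin 4} (hμν : μ ≠ ν) :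
    12 * B12Beta.secondMoment (TbalOf Lc (JsRowD1Pin hLc N) j) μ ν = -(1 / 2) * ∑ ν, ∑' z, TbalOf Lc (JsRowD1Pin hLc N) j ν ν z * ∑ μ, (z μ : ℝ) ^ 2 := by
  rw [← secondMoment_flipK, twelve_mul_secondMoment_eq_trace_of_permCovariant (momentSummable_flipK_TbalOf _ j 3) ((symmetries_JsRowD1Pin hLc hN).1 j)
    (indexSymmetric_flipK_TbalOf_JsRowD1Pin hLc N j) hC hμν]
  simp_rw [tsum_diag_normSq_flipK]

end CoDressed

/-! ## §4 The b2b wall's (III′) literal under `hW_j` -/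

section Record

variable {Lc : ℕ} [NeZero Lc]

/-- [folklore] **THE REYNOLDS MEAN's COEFFICIENT OF THE (III′) LITERAL UNDER `hW_j` IS THE TRACE SCALAR** (every table record `tabs`, `N`, `cΛ`, `cB`, level; `Odd Lc`; `μ ≠ ν`). -/
theorem twelve_mul_secondMoment_reynoldsMean_JsB12CombShSym_eq_trace_of_hW (hLc : Odd Lc) (N : ℕ) (tabs : SymTables 3 Lc) (cΛ cB : ℝ) (j : ℕ)
    (hW : WardTransversal (flipK (TbalOf Lc (JsB12CombShSym hLc N tabs cΛ cB) j))) {μ ν : Fin 4} (hμν : μ ≠ ν) :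
    12 * B12Beta.secondMoment (reynoldsMean (flipK (TbalOf Lc (JsB12CombShSym hLc N tabs cΛ cB) j))) μ ν =
      -(1 / 2) * ∑ ν, ∑' z, TbalOf Lc (JsB12CombShSym hLc N tabs cΛ cB) j ν ν z * ∑ μ, (z μ : ℝ) ^ 2 := by
  rw [twelve_mul_secondMoment_reynoldsMean_eq_trace (momentSummable_flipK_TbalOf _ j 3) hW (indexSymmetric_flipK_TbalOf_JsB12CombShSym hLc N tabs cΛ cB j) hμν]
  simp_rw [tsum_diag_normSq_flipK]

end Record

end Summit.QuantumFields.BalabanUV.Gaps.D1WardTraceForm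

end
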